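import Literature.Analysis.FluidPDE.NSSliceTimeBumps
import Literature.Analysis.FluidPDE.WeakGradientSlicing
import Literature.Analysis.FluidPDE.NSSuitableESS
import Literature.Analysis.FunctionSpaces.AubinLionsExtraction
import Mathlib.MeasureTheory.Integral.MeanInequalities
import HarnessLib

/-!
# Strong `L²` compactness of the velocities of distributional Navier–Stokes solutions on a
cylinder `(a, b) × Ω` with uniform `L^∞_t L²_x`, `L²_t H¹_x` and `L^{3/2}` pressure bounds

Analysis/FluidPDE theorem file (no definitions, no named facts). It supplies the
Navier–Stokes-specific input of the Aubin–Lions / Rellich–Lions compactness step of every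
construction of weak solutions by compactness on a cylinder `W = (a, b) × Ω` — the velocity part
of the "compactness of suitable weak solutions" (Lin 1998, Thm. 2.2; Caffarelli–Kohn–Nirenberg
1982; Albritton–Barker 2019, Lemma 2.2, the tree's `SuitableCompactness`) and of Bradshaw–Tsai
2019, §4.3 ("`vₖ` are uniformly bounded in `L^∞(0,T;L²(B₁)) ∩ L²(0,T;H¹(B₁))` … `πₖ` in
`L^{3/2}` … `vₖ` converges to `v` … in `L²(0,T;L²(B₁))`", the first part of the tree's named fact
`bradshawTsai2019_cylinderCompactness`) — and plugs it into the generic theorem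
`AubinLions.exists_subseq_strong_limit_of_equicontinuous` (`FunctionSpaces/AubinLionsExtraction`,
built on Ehrling's lemma and Rellich–Kondrachov):

* `NSCylinder.setIntegral_deriv_mul_pairing_add_eq_zero`,
  `NSCylinder.exists_ae_pairing_eq_const_add_primitive` — testing the momentum equation with
  `χ(t) η(x)` on a product cylinder for solutions with `u ∈ L²(W)`, `p ∈ L¹(W)` (the tree's
  `NSSliceTimePairing` treats bounded `u`): `∫_Ω ⟪u(t), η⟫ = c + ∫_{(a,t]} f_η` for a.e. `t`,
  `f_η = ∫_Ω (⟪u, Dη u⟫ + ⟪u, Δη⟫ + p div η)`;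
* `NSCylinder.ae_abs_remainder_le`, `NSCylinder.setIntegral_pressureSlice_le`,
  `NSCylinder.exists_fullMeasure_pairing_modulus` — **weak equicontinuity in time**: with
  `∫_Ω ‖u(t)‖² ≤ C` a.e. and `∫∫_W |p|^{3/2} ≤ C_p`, the pairings satisfy
  `|∫_Ω ⟪u(t), η⟫ - ∫_Ω ⟪u(s), η⟫| ≤ A |t - s| + B |t - s|^{1/3}` for all `t, s` in a full-measure
  set of times, `A`, `B` depending on the solution only through `C`, `C_p` (Hölder in space and
  time for the pressure term);
* `NSCylinder.exists_subseq_strong_limit_velocity` (bounded Lipschitz `Ω`) and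
  `NSCylinder.exists_subseq_strong_limit_velocity_ball` — **the compactness theorem**: sequences
  `(vₖ, πₖ)` of distributional solutions on `W` with the three uniform bounds have a subsequence
  whose velocities converge strongly in `L²(W)` (and slice-wise in `𝓓'(Ω)` for a.e. `t`) to a
  jointly measurable `u` with `∫_Ω ‖u(t)‖² ≤ C` for a.e. `t`.

What remains for the full compactness statement of suitable weak solutions (the limit is again a
suitable weak solution with the same bounds, pressures converge weakly in `L^{3/2}`) is the
stability part: weak limits of the gradients and pressures (`FunctionSpaces/WeakCompactnessLpFinite`,
`SpaceTimeWeakCompactness`), strong `L³` convergence by interpolation with the `L^{10/3}` bound, and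
passage to the limit in the weak form and in the local energy inequality.

## Mathlib / tree search

Used from Mathlib: `ENNReal.lintegral_mul_le_Lp_mul_Lq` (Hölder), `integral_prod`, Fubini
(`Integrable.integral_prod_left`, `Integrable.prod_right_ae`), `integral_inner`,
`MemLp.integrable_norm_rpow`. From the tree: `isSpaceTimeTestOn_prod_smul`, `timeDeriv_prod_smul`,
`exists_bounds_of_isTestFunctionOn`, `exists_ae_eq_const_add_primitive` (`NSSliceTimePairing`,
whose bounded-velocity versions are the template), `integrable_time_mul`, `convect_fun_const_smul`
&c. (`DistributionalToWeak`), `HasWeakSpatialGradientOn.ae_hasWeakFDerivOn_slice`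
(`WeakGradientSlicing`), `timeCylinder` (`NSSuitableESS`), `isLipschitzDomain_ball`
(`BallLipschitzDomain`) and the `AubinLions`/`Ehrling` files. No compactness theorem for weak
Navier–Stokes solutions on cylinders existed in the tree (searched `compactness`, `equicontin`,
`Aubin`, `strong` in `Literature/Analysis/FluidPDE`; `NSLerayRegularisedLimit` is the whole-space
Leray argument relying on the energy equality of smooth approximants).

## References

* Z. Bradshaw, T.-P. Tsai, *Discretely self-similar solutions to the Navier–Stokes equations with
  data in `L²_loc` satisfying the local energy inequality*, Analysis & PDE 12 (2019) =
  arXiv:1801.08060, §4.3 (proof of Thm. 1.2, p. 12). [BradshawTsai2019]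
* F. Lin, *A new proof of the Caffarelli–Kohn–Nirenberg theorem*, CPAM 51 (1998), Thm. 2.2.
  [Lin1998]
* P. G. Lemarié-Rieusset, *The Navier–Stokes problem in the 21st century* (CRC, 2016), §12.1,
  Thm. 12.1 (Rellich–Lions), Thm. 12.2. [Lemarierieusset2016]
* R. Temam, *Navier–Stokes equations* (North-Holland, 1977/79), Ch. III, §2 Thm. 2.1, §3
  (3.40)–(3.43). [Temam1979]
* J. C. Robinson, J. L. Rodrigo, W. Sadowski, *The three-dimensional Navier–Stokes equations*
  (CUP, 2016), §13.5, Lemma 13.8. [RobinsonRodrigoSadowski2016]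
-/

noncomputable section

open MeasureTheory TopologicalSpace Set Function Filter Topology Metric Bornology intervalIntegral
open scoped NNReal ENNReal InnerProductSpace RealInnerProductSpace Laplacian

namespace Literature.Analysis.FluidPDE

/-! ### Integrability on a product cylinder `(a, b) × Ω` from square integrability -/

section Cylinder

variable {u : ℝ → (EuclideanSpace ℝ (Fin 3)) → (EuclideanSpace ℝ (Fin 3))} {p : ℝ → (EuclideanSpace ℝ (Fin 3)) → ℝ} {Ω : Opens (EuclideanSpace ℝ (Fin 3))} {a b : ℝ}

/-- The product cylinder over a bounded open set has finite volume. [folklore] -/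
theorem NSCylinder.isFiniteMeasure_restrict (hbΩ : IsBounded (Ω : Set (EuclideanSpace ℝ (Fin 3)))) (a b : ℝ) :
    IsFiniteMeasure ((volume : Measure (ℝ × (EuclideanSpace ℝ (Fin 3)))).restrict (Ioo a b ×ˢ (Ω : Set (EuclideanSpace ℝ (Fin 3))))) := by
  refine ⟨?_⟩
  rw [Measure.restrict_apply_univ, Measure.volume_eq_prod, Measure.prod_prod]
  exact ENNReal.mul_lt_top measure_Ioo_lt_top
    ((measure_mono subset_closure).trans_lt hbΩ.isCompact_closure.measure_lt_top)

/-- A square-integrable field on the (finite) cylinder is integrable there. [folklore] -/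
theorem NSCylinder.integrable_of_lintegral_sq (hbΩ : IsBounded (Ω : Set (EuclideanSpace ℝ (Fin 3))))
    (hm : AEStronglyMeasurable (uncurry u) (volume.restrict (Ioo a b ×ˢ (Ω : Set (EuclideanSpace ℝ (Fin 3))))))
    (hu2 : ∫⁻ z in Ioo a b ×ˢ (Ω : Set (EuclideanSpace ℝ (Fin 3))), ‖u z.1 z.2‖ₑ ^ 2 < ∞) :
    Integrable (uncurry u) (volume.restrict (Ioo a b ×ˢ (Ω : Set (EuclideanSpace ℝ (Fin 3))))) := by
  haveI := NSCylinder.isFiniteMeasure_restrict hbΩ a b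
  have h2 : MemLp (uncurry u) 2 (volume.restrict (Ioo a b ×ˢ (Ω : Set (EuclideanSpace ℝ (Fin 3))))) := by
    refine ⟨hm, ?_⟩
    rw [FunctionSpaces.AubinLions.eLpNorm_two_eq_rpow]
    exact ENNReal.rpow_lt_top_of_nonneg (by norm_num) hu2.ne
  exact memLp_one_iff_integrable.1 (h2.mono_exponent one_le_two)

/-- The squared norm of a square-integrable field is integrable on the cylinder. [folklore] -/
theorem NSCylinder.integrable_norm_sq_of_lintegral_sq
    (hm : AEStronglyMeasurable (uncurry u) (volume.restrict (Ioo a b ×ˢ (Ω : Set (EuclideanSpace ℝ (Fin 3))))))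
    (hu2 : ∫⁻ z in Ioo a b ×ˢ (Ω : Set (EuclideanSpace ℝ (Fin 3))), ‖u z.1 z.2‖ₑ ^ 2 < ∞) :
    Integrable (fun z : ℝ × (EuclideanSpace ℝ (Fin 3)) => ‖u z.1 z.2‖ ^ 2) (volume.restrict (Ioo a b ×ˢ (Ω : Set (EuclideanSpace ℝ (Fin 3))))) := by
  have h2 : MemLp (uncurry u) 2 (volume.restrict (Ioo a b ×ˢ (Ω : Set (EuclideanSpace ℝ (Fin 3))))) := by
    refine ⟨hm, ?_⟩
    rw [FunctionSpaces.AubinLions.eLpNorm_two_eq_rpow]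
    exact ENNReal.rpow_lt_top_of_nonneg (by norm_num) hu2.ne
  have h := h2.integrable_norm_rpow two_ne_zero ENNReal.ofNat_ne_top
  refine h.congr (Eventually.of_forall fun z => ?_)
  simp only [ENNReal.toReal_ofNat, Real.rpow_two]
  rfl

/-- A pressure in `L^{3/2}` of the (finite) cylinder is integrable there. [folklore] -/
theorem NSCylinder.integrable_pressure_of_lintegral_rpow (hbΩ : IsBounded (Ω : Set (EuclideanSpace ℝ (Fin 3))))
    (hm : AEStronglyMeasurable (uncurry p) (volume.restrict (Ioo a b ×ˢ (Ω : Set (EuclideanSpace ℝ (Fin 3))))))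
    (hp : ∫⁻ z in Ioo a b ×ˢ (Ω : Set (EuclideanSpace ℝ (Fin 3))), ‖p z.1 z.2‖ₑ ^ (3 / 2 : ℝ) < ∞) :
    Integrable (uncurry p) (volume.restrict (Ioo a b ×ˢ (Ω : Set (EuclideanSpace ℝ (Fin 3))))) := by
  haveI := NSCylinder.isFiniteMeasure_restrict hbΩ a b
  have h32 : (3 / 2 : ℝ≥0∞) = ENNReal.ofReal (3 / 2) := by
    rw [ENNReal.ofReal_div_of_pos (by norm_num)]; simp
  have hmem : MemLp (uncurry p) (3 / 2 : ℝ≥0∞) (volume.restrict (Ioo a b ×ˢ (Ω : Set (EuclideanSpace ℝ (Fin 3))))) := by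
    refine ⟨hm, ?_⟩
    rw [eLpNorm_lt_top_iff_lintegral_rpow_enorm_lt_top (by norm_num) (by rw [h32]; simp)]
    rw [h32, ENNReal.toReal_ofReal (by norm_num)]
    simpa [uncurry] using hp
  exact hmem.integrable (by rw [h32]; exact ENNReal.one_le_ofReal.2 (by norm_num))

/-- The pairing integrand `⟪u, η⟫` is integrable on the cylinder for a bounded continuous `η`.
[folklore] -/
theorem NSCylinder.integrable_inner_test
    (hu : Integrable (uncurry u) (volume.restrict (Ioo a b ×ˢ (Ω : Set (EuclideanSpace ℝ (Fin 3))))))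
    {η : (EuclideanSpace ℝ (Fin 3)) → (EuclideanSpace ℝ (Fin 3))} (hηc : Continuous η) {K₀ : ℝ} (hK₀ : ∀ x, ‖η x‖ ≤ K₀) :
    Integrable (fun w : ℝ × (EuclideanSpace ℝ (Fin 3)) => ⟪u w.1 w.2, η w.2⟫)
      (volume.restrict (Ioo a b ×ˢ (Ω : Set (EuclideanSpace ℝ (Fin 3))))) := by
  refine Integrable.mono' (hu.norm.mul_const K₀)
    (hu.1.inner (hηc.comp continuous_snd).aestronglyMeasurable) (Eventually.of_forall fun w => ?_)
  exact (norm_inner_le_norm _ _).trans (mul_le_mul_of_nonneg_left (hK₀ w.2) (norm_nonneg _))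

/-- The remainder `⟪u, Dη u⟫ + ⟪u, Δη⟫ + p div η` is integrable on the cylinder when `u` is
square integrable and `p` integrable there. [folklore] -/
theorem NSCylinder.integrable_remainder_test
    (hu : Integrable (uncurry u) (volume.restrict (Ioo a b ×ˢ (Ω : Set (EuclideanSpace ℝ (Fin 3))))))
    (hu2 : Integrable (fun z : ℝ × (EuclideanSpace ℝ (Fin 3)) => ‖u z.1 z.2‖ ^ 2) (volume.restrict (Ioo a b ×ˢ (Ω : Set (EuclideanSpace ℝ (Fin 3))))))
    (hpi : Integrable (uncurry p) (volume.restrict (Ioo a b ×ˢ (Ω : Set (EuclideanSpace ℝ (Fin 3))))))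
    {η : (EuclideanSpace ℝ (Fin 3)) → (EuclideanSpace ℝ (Fin 3))} (hη1 : ContDiff ℝ 2 η) {K₁ K₂ : ℝ} (hK₁ : ∀ x, ‖fderiv ℝ η x‖ ≤ K₁)
    (hK₂ : ∀ x, ‖Δ η x‖ ≤ K₂) :
    Integrable (fun w : ℝ × (EuclideanSpace ℝ (Fin 3)) => ⟪u w.1 w.2, fderiv ℝ η w.2 (u w.1 w.2)⟫ + ⟪u w.1 w.2, Δ η w.2⟫ +
        p w.1 w.2 * VectorCalculus.divergence η w.2)
      (volume.restrict (Ioo a b ×ˢ (Ω : Set (EuclideanSpace ℝ (Fin 3))))) := by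
  have cD : Continuous (fderiv ℝ η) := hη1.continuous_fderiv (by simp)
  have cL : Continuous (Δ η) := continuous_laplacian hη1
  have hdiv : Continuous (VectorCalculus.divergence η) := continuous_divergence cD
  have hdivb : ∀ x, ‖VectorCalculus.divergence η x‖ ≤ 3 * K₁ := fun x => by
    set bb := EuclideanSpace.basisFun (Fin 3) ℝ
    rw [divergence_eq_sum_inner_fderiv bb η x, Real.norm_eq_abs]
    calc |∑ i, ⟪bb i, fderiv ℝ η x (bb i)⟫|
        ≤ ∑ i, |⟪bb i, fderiv ℝ η x (bb i)⟫| := Finset.abs_sum_le_sum_abs _ _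
      _ ≤ ∑ _i : Fin 3, K₁ := Finset.sum_le_sum fun i _ => ?_
      _ = 3 * K₁ := by simp
    calc |⟪bb i, fderiv ℝ η x (bb i)⟫| ≤ ‖bb i‖ * ‖fderiv ℝ η x (bb i)‖ := abs_real_inner_le_norm _ _
      _ ≤ 1 * (‖fderiv ℝ η x‖ * 1) := by
          rw [bb.norm_eq_one i]
          gcongr
          simpa [bb.norm_eq_one i] using (fderiv ℝ η x).le_opNorm (bb i)
      _ ≤ K₁ := by simpa using hK₁ x
  -- the quadratic term
  have i1 : Integrable (fun w : ℝ × (EuclideanSpace ℝ (Fin 3)) => ⟪u w.1 w.2, fderiv ℝ η w.2 (u w.1 w.2)⟫)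
      (volume.restrict (Ioo a b ×ˢ (Ω : Set (EuclideanSpace ℝ (Fin 3))))) := by
    have hm : AEStronglyMeasurable (fun w : ℝ × (EuclideanSpace ℝ (Fin 3)) => ⟪u w.1 w.2, fderiv ℝ η w.2 (u w.1 w.2)⟫)
        (volume.restrict (Ioo a b ×ˢ (Ω : Set (EuclideanSpace ℝ (Fin 3))))) :=
      hu.1.inner (isBoundedBilinearMap_apply.continuous.comp_aestronglyMeasurable
        ((cD.comp continuous_snd).aestronglyMeasurable.prodMk hu.1))
    refine Integrable.mono' (hu2.const_mul K₁) hm (Eventually.of_forall fun w => ?_)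
    calc ‖⟪u w.1 w.2, fderiv ℝ η w.2 (u w.1 w.2)⟫‖
        ≤ ‖u w.1 w.2‖ * ‖fderiv ℝ η w.2 (u w.1 w.2)‖ := norm_inner_le_norm _ _
      _ ≤ ‖u w.1 w.2‖ * (K₁ * ‖u w.1 w.2‖) := by
          gcongr
          exact (ContinuousLinearMap.le_opNorm _ _).trans
            (mul_le_mul_of_nonneg_right (hK₁ w.2) (norm_nonneg _))
      _ = K₁ * ‖u w.1 w.2‖ ^ 2 := by ring
  -- the Laplacian term
  have i2 : Integrable (fun w : ℝ × (EuclideanSpace ℝ (Fin 3)) => ⟪u w.1 w.2, Δ η w.2⟫)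
      (volume.restrict (Ioo a b ×ˢ (Ω : Set (EuclideanSpace ℝ (Fin 3))))) := by
    refine Integrable.mono' (hu.norm.mul_const K₂)
      (hu.1.inner (cL.comp continuous_snd).aestronglyMeasurable) (Eventually.of_forall fun w => ?_)
    exact (norm_inner_le_norm _ _).trans (mul_le_mul_of_nonneg_left (hK₂ w.2) (norm_nonneg _))
  -- the pressure term
  have i3 : Integrable (fun w : ℝ × (EuclideanSpace ℝ (Fin 3)) => p w.1 w.2 * VectorCalculus.divergence η w.2)
      (volume.restrict (Ioo a b ×ˢ (Ω : Set (EuclideanSpace ℝ (Fin 3))))) := by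
    have : (fun w : ℝ × (EuclideanSpace ℝ (Fin 3)) => p w.1 w.2 * VectorCalculus.divergence η w.2) =
        fun w => VectorCalculus.divergence η w.2 * uncurry p w := by
      ext w; simp [uncurry, mul_comm]
    rw [this]
    exact hpi.bdd_mul (hdiv.comp continuous_snd).aestronglyMeasurable
      (Eventually.of_forall fun w => hdivb w.2)
  exact (i1.add i2).add i3

/-- **Testing the momentum equation with `χ(t) η(x)` on a product cylinder.** For a
distributional solution of Navier–Stokes (`ν = 1`, no force) in `W = (a, b) × Ω`, `Ω` bounded,
with `u ∈ L²(W)` and `p ∈ L¹(W)`, a smooth `χ` compactly supported in `(a, b)` and a test field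
`η` on `Ω`:
`∫_a^b (χ'(t) ∫_Ω ⟪u(t), η⟫ + χ(t) ∫_Ω (⟪u, Dη u⟫ + ⟪u, Δη⟫ + p div η)(t)) dt = 0`
(the distributional identity for `ψ = χ ⊗ η` followed by Fubini; twin of
`setIntegral_deriv_mul_pairing_add_eq_zero` of `NSSliceTimePairing`, which assumes `u` bounded).
[folklore] -/
theorem NSCylinder.setIntegral_deriv_mul_pairing_add_eq_zero
    (hsol : IsDistributionalNSSolutionOn (timeCylinder Ω a b) 1 0 u p)
    (hbΩ : IsBounded (Ω : Set (EuclideanSpace ℝ (Fin 3))))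
    (hu2 : ∫⁻ z in Ioo a b ×ˢ (Ω : Set (EuclideanSpace ℝ (Fin 3))), ‖u z.1 z.2‖ₑ ^ 2 < ∞)
    (hpi : Integrable (uncurry p) (volume.restrict (Ioo a b ×ˢ (Ω : Set (EuclideanSpace ℝ (Fin 3))))))
    {χ : ℝ → ℝ} (hχ : ContDiff ℝ (⊤ : ℕ∞) χ) (hχc : HasCompactSupport χ)
    (hχI : tsupport χ ⊆ Ioo a b)
    {η : (EuclideanSpace ℝ (Fin 3)) → (EuclideanSpace ℝ (Fin 3))} (hη : FunctionSpaces.IsTestFunctionOn Ω η) :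
    ∫ t in Ioo a b,
      ((deriv χ t * ∫ x in (Ω : Set (EuclideanSpace ℝ (Fin 3))), ⟪u t x, η x⟫) +
        χ t * ∫ x in (Ω : Set (EuclideanSpace ℝ (Fin 3))), (⟪u t x, fderiv ℝ η x (u t x)⟫ + ⟪u t x, Δ η x⟫ +
          p t x * VectorCalculus.divergence η x)) = 0 := by
  obtain ⟨K₀, K₁, K₂, hK₀, hK₁, hK₂⟩ := exists_bounds_of_isTestFunctionOn hη
  have hηd : Differentiable ℝ η := hη.contDiff.differentiable (by simp)
  have hη2 : ContDiff ℝ 2 η := hη.contDiff.of_le (by norm_cast)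
  have hχd : Differentiable ℝ χ := hχ.differentiable (by simp)
  obtain ⟨Cχ, hCχ⟩ := hχ.continuous.bounded_above_of_compact_support hχc
  obtain ⟨Cχ', hCχ'⟩ := (hχ.continuous_deriv (by simp)).bounded_above_of_compact_support hχc.deriv
  have hm : AEStronglyMeasurable (uncurry u) (volume.restrict (Ioo a b ×ˢ (Ω : Set (EuclideanSpace ℝ (Fin 3))))) :=
    hsol.1.aestronglyMeasurable
  have hu := NSCylinder.integrable_of_lintegral_sq hbΩ hm hu2
  have hu2' := NSCylinder.integrable_norm_sq_of_lintegral_sq hm hu2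
  -- the distributional identity for `ψ = χ ⊗ η`
  have hψ : IsSpaceTimeTestOn (timeCylinder Ω a b) (fun s x => χ s • η x) :=
    isSpaceTimeTestOn_prod_smul isOpen_Ioo Ω.isOpen hχ hχc hχI hη
  have key := hsol.2.2.2.2 _ hψ
  -- the two integrable pieces
  set G : ℝ × (EuclideanSpace ℝ (Fin 3)) → ℝ := fun w => ⟪u w.1 w.2, fderiv ℝ η w.2 (u w.1 w.2)⟫ + ⟪u w.1 w.2, Δ η w.2⟫ +
    p w.1 w.2 * VectorCalculus.divergence η w.2 with hG
  have iU : Integrable (fun w : ℝ × (EuclideanSpace ℝ (Fin 3)) => ⟪u w.1 w.2, η w.2⟫)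
      (volume.restrict (Ioo a b ×ˢ (Ω : Set (EuclideanSpace ℝ (Fin 3))))) :=
    NSCylinder.integrable_inner_test hu hη.contDiff.continuous hK₀
  have iG : Integrable G (volume.restrict (Ioo a b ×ˢ (Ω : Set (EuclideanSpace ℝ (Fin 3))))) :=
    NSCylinder.integrable_remainder_test hu hu2' hpi hη2 hK₁ hK₂
  have iU' : Integrable (fun w : ℝ × (EuclideanSpace ℝ (Fin 3)) => deriv χ w.1 * ⟪u w.1 w.2, η w.2⟫)
      (volume.restrict (Ioo a b ×ˢ (Ω : Set (EuclideanSpace ℝ (Fin 3))))) :=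
    integrable_time_mul iU (hχ.continuous_deriv (by simp)) (C := Cχ')
      fun s => by simpa [Real.norm_eq_abs] using hCχ' s
  have iG' : Integrable (fun w : ℝ × (EuclideanSpace ℝ (Fin 3)) => χ w.1 * G w)
      (volume.restrict (Ioo a b ×ˢ (Ω : Set (EuclideanSpace ℝ (Fin 3))))) :=
    integrable_time_mul iG hχ.continuous (C := Cχ) fun s => by simpa [Real.norm_eq_abs] using hCχ s
  -- rewrite the tested integrand
  have key' : ∫ w in Ioo a b ×ˢ (Ω : Set (EuclideanSpace ℝ (Fin 3))),
      (deriv χ w.1 * ⟪u w.1 w.2, η w.2⟫ + χ w.1 * G w) = 0 := by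
    refine Eq.trans (setIntegral_congr_fun
      (measurableSet_Ioo.prod Ω.isOpen.measurableSet) fun w _ => ?_) key
    rw [hG]
    dsimp only
    rw [timeDeriv_prod_smul hχd, convect_fun_const_smul _ (hηd w.2),
      laplacian_fun_const_smul hη2, divergence_fun_const_smul (hηd w.2)]
    simp only [inner_smul_right, Pi.zero_apply, inner_zero_left, one_mul, convect]
    ring
  -- Fubini
  rw [FunctionSpaces.AubinLions.volume_restrict_prod] at key' iU iG iU' iG'
  have iS : Integrable (fun w : ℝ × (EuclideanSpace ℝ (Fin 3)) => deriv χ w.1 * ⟪u w.1 w.2, η w.2⟫ + χ w.1 * G w)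
      (((volume : Measure ℝ).restrict (Ioo a b)).prod
        ((volume : Measure (EuclideanSpace ℝ (Fin 3))).restrict (Ω : Set (EuclideanSpace ℝ (Fin 3))))) := iU'.add iG'
  rw [integral_prod _ iS] at key'
  have hae : ∀ᵐ t ∂((volume : Measure ℝ).restrict (Ioo a b)),
      (∫ x in (Ω : Set (EuclideanSpace ℝ (Fin 3))), (deriv χ t * ⟪u t x, η x⟫ + χ t * G (t, x))) =
        (deriv χ t * ∫ x in (Ω : Set (EuclideanSpace ℝ (Fin 3))), ⟪u t x, η x⟫) +
          χ t * ∫ x in (Ω : Set (EuclideanSpace ℝ (Fin 3))), (⟪u t x, fderiv ℝ η x (u t x)⟫ + ⟪u t x, Δ η x⟫ +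
            p t x * VectorCalculus.divergence η x) := by
    filter_upwards [iU.prod_right_ae, iG.prod_right_ae] with t h1 h2
    rw [integral_add (h1.const_mul _) (h2.const_mul _), MeasureTheory.integral_const_mul,
      MeasureTheory.integral_const_mul]
  rw [← integral_congr_ae hae]
  exact key'

/-- **The pairing is a primitive, a.e.** In the setting of
`NSCylinder.setIntegral_deriv_mul_pairing_add_eq_zero`: for some constant `c` and a.e.
`t ∈ (a, b)`, `∫_Ω ⟪u(t), η⟫ = c + ∫_{(a,t]} ∫_Ω (⟪u, Dη u⟫ + ⟪u, Δη⟫ + p div η)` (du Bois-Reymond,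
`exists_ae_eq_const_add_primitive`). [folklore] -/
theorem NSCylinder.exists_ae_pairing_eq_const_add_primitive
    (hsol : IsDistributionalNSSolutionOn (timeCylinder Ω a b) 1 0 u p)
    (hbΩ : IsBounded (Ω : Set (EuclideanSpace ℝ (Fin 3))))
    (hu2 : ∫⁻ z in Ioo a b ×ˢ (Ω : Set (EuclideanSpace ℝ (Fin 3))), ‖u z.1 z.2‖ₑ ^ 2 < ∞)
    (hpi : Integrable (uncurry p) (volume.restrict (Ioo a b ×ˢ (Ω : Set (EuclideanSpace ℝ (Fin 3))))))
    {η : (EuclideanSpace ℝ (Fin 3)) → (EuclideanSpace ℝ (Fin 3))} (hη : FunctionSpaces.IsTestFunctionOn Ω η) :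
    ∃ c : ℝ, ∀ᵐ t ∂(volume.restrict (Ioo a b)),
      (∫ x in (Ω : Set (EuclideanSpace ℝ (Fin 3))), ⟪u t x, η x⟫) = c + ∫ s in Ioc a t,
        ∫ x in (Ω : Set (EuclideanSpace ℝ (Fin 3))), (⟪u s x, fderiv ℝ η x (u s x)⟫ + ⟪u s x, Δ η x⟫ +
          p s x * VectorCalculus.divergence η x) := by
  obtain ⟨K₀, K₁, K₂, hK₀, hK₁, hK₂⟩ := exists_bounds_of_isTestFunctionOn hη
  have hη2 : ContDiff ℝ 2 η := hη.contDiff.of_le (by norm_cast)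
  have hm : AEStronglyMeasurable (uncurry u) (volume.restrict (Ioo a b ×ˢ (Ω : Set (EuclideanSpace ℝ (Fin 3))))) :=
    hsol.1.aestronglyMeasurable
  have hu := NSCylinder.integrable_of_lintegral_sq hbΩ hm hu2
  have hu2' := NSCylinder.integrable_norm_sq_of_lintegral_sq hm hu2
  have iU := NSCylinder.integrable_inner_test hu hη.contDiff.continuous hK₀
  have iG := NSCylinder.integrable_remainder_test hu hu2' hpi hη2 hK₁ hK₂
  rw [FunctionSpaces.AubinLions.volume_restrict_prod] at iU iG
  refine exists_ae_eq_const_add_primitive iU.integral_prod_left iG.integral_prod_left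
    fun χ hχ hχc hχI => ?_
  exact NSCylinder.setIntegral_deriv_mul_pairing_add_eq_zero hsol hbΩ hu2 hpi hχ hχc hχI hη

end Cylinder

/-! ### Slice bounds and the modulus of continuity of the pairings -/

section Modulus

variable {u : ℝ → (EuclideanSpace ℝ (Fin 3)) → (EuclideanSpace ℝ (Fin 3))} {p : ℝ → (EuclideanSpace ℝ (Fin 3)) → ℝ} {Ω : Opens (EuclideanSpace ℝ (Fin 3))} {a b : ℝ}

/-- `‖y‖ ≤ 1 + ‖y‖²`. [folklore] -/
theorem NSCylinder.norm_le_one_add_sq (y : (EuclideanSpace ℝ (Fin 3))) : ‖y‖ ≤ 1 + ‖y‖ ^ 2 := by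
  nlinarith [norm_nonneg y, sq_nonneg (‖y‖ - 1)]

/-- The real slice energy is bounded by the `ℝ≥0∞` slice bound: `∫_Ω ‖u(t)‖² ≤ C`. [folklore] -/
theorem NSCylinder.integral_norm_sq_le_toReal {v : (EuclideanSpace ℝ (Fin 3)) → (EuclideanSpace ℝ (Fin 3))} {C : ℝ≥0∞} (hC : C ≠ ⊤)
    (hv : AEStronglyMeasurable v (volume.restrict (Ω : Set (EuclideanSpace ℝ (Fin 3)))))
    (h : ∫⁻ x in (Ω : Set (EuclideanSpace ℝ (Fin 3))), ‖v x‖ₑ ^ 2 ≤ C) :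
    ∫ x in (Ω : Set (EuclideanSpace ℝ (Fin 3))), ‖v x‖ ^ 2 ≤ C.toReal := by
  have hmeas : AEStronglyMeasurable (fun x => ‖v x‖ ^ 2) (volume.restrict (Ω : Set (EuclideanSpace ℝ (Fin 3)))) :=
    hv.norm.pow 2
  rw [integral_eq_lintegral_of_nonneg_ae (Eventually.of_forall fun x => by positivity) hmeas]
  refine ENNReal.toReal_mono hC (le_trans (le_of_eq (lintegral_congr fun x => ?_)) h)
  rw [← ofReal_norm, ENNReal.ofReal_pow (norm_nonneg _)]

/-- Square integrability of a slice from the `ℝ≥0∞` slice bound. [folklore] -/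
theorem NSCylinder.memLp_two_slice {v : (EuclideanSpace ℝ (Fin 3)) → (EuclideanSpace ℝ (Fin 3))} {C : ℝ≥0∞} (hC : C ≠ ⊤)
    (hv : AEStronglyMeasurable v (volume.restrict (Ω : Set (EuclideanSpace ℝ (Fin 3)))))
    (h : ∫⁻ x in (Ω : Set (EuclideanSpace ℝ (Fin 3))), ‖v x‖ₑ ^ 2 ≤ C) : MemLp v 2 (volume.restrict (Ω : Set (EuclideanSpace ℝ (Fin 3)))) := by
  refine ⟨hv, ?_⟩
  rw [FunctionSpaces.AubinLions.eLpNorm_two_eq_rpow]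
  exact ENNReal.rpow_lt_top_of_nonneg (by norm_num) (h.trans_lt hC.lt_top).ne

/-- **The remainder is bounded by the energy and the pressure slice, a.e. in time.** With
`∫_Ω ‖u(t)‖² ≤ C` for a.e. `t`, `p ∈ L¹(W)`, `‖Dη‖ ≤ K₁`, `‖Δη‖ ≤ K₂`:
`|∫_Ω (⟪u, Dη u⟫ + ⟪u, Δη⟫ + p div η)(t)| ≤ K₁ C + K₂ (|Ω| + C) + 3 K₁ ∫_Ω |p(t)|` for a.e. `t`.
[folklore] -/
theorem NSCylinder.ae_abs_remainder_le (hbΩ : IsBounded (Ω : Set (EuclideanSpace ℝ (Fin 3))))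
    (hm : AEStronglyMeasurable (uncurry u) (volume.restrict (Ioo a b ×ˢ (Ω : Set (EuclideanSpace ℝ (Fin 3))))))
    {C : ℝ≥0∞} (hC : C ≠ ⊤)
    (hE : ∀ᵐ t ∂(volume.restrict (Ioo a b)), ∫⁻ x in (Ω : Set (EuclideanSpace ℝ (Fin 3))), ‖u t x‖ₑ ^ 2 ≤ C)
    (hpi : Integrable (uncurry p) (volume.restrict (Ioo a b ×ˢ (Ω : Set (EuclideanSpace ℝ (Fin 3))))))
    {η : (EuclideanSpace ℝ (Fin 3)) → (EuclideanSpace ℝ (Fin 3))} (hη2 : ContDiff ℝ 2 η) {K₁ K₂ : ℝ} (hK₁ : ∀ x, ‖fderiv ℝ η x‖ ≤ K₁)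
    (hK₂ : ∀ x, ‖Δ η x‖ ≤ K₂) :
    ∀ᵐ t ∂(volume.restrict (Ioo a b)),
      |∫ x in (Ω : Set (EuclideanSpace ℝ (Fin 3))), (⟪u t x, fderiv ℝ η x (u t x)⟫ + ⟪u t x, Δ η x⟫ +
          p t x * VectorCalculus.divergence η x)| ≤
        K₁ * C.toReal + K₂ * ((volume (Ω : Set (EuclideanSpace ℝ (Fin 3)))).toReal + C.toReal) +
          3 * K₁ * ∫ x in (Ω : Set (EuclideanSpace ℝ (Fin 3))), |p t x| := by
  haveI : IsFiniteMeasure ((volume : Measure (EuclideanSpace ℝ (Fin 3))).restrict (Ω : Set (EuclideanSpace ℝ (Fin 3)))) := ⟨by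
    rw [Measure.restrict_apply_univ]
    exact (measure_mono subset_closure).trans_lt hbΩ.isCompact_closure.measure_lt_top⟩
  have hdivb : ∀ x, ‖VectorCalculus.divergence η x‖ ≤ 3 * K₁ := fun x => by
    set bb := EuclideanSpace.basisFun (Fin 3) ℝ
    rw [divergence_eq_sum_inner_fderiv bb η x, Real.norm_eq_abs]
    calc |∑ i, ⟪bb i, fderiv ℝ η x (bb i)⟫|
        ≤ ∑ i, |⟪bb i, fderiv ℝ η x (bb i)⟫| := Finset.abs_sum_le_sum_abs _ _
      _ ≤ ∑ _i : Fin 3, K₁ := Finset.sum_le_sum fun i _ => ?_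
      _ = 3 * K₁ := by simp
    calc |⟪bb i, fderiv ℝ η x (bb i)⟫| ≤ ‖bb i‖ * ‖fderiv ℝ η x (bb i)‖ := abs_real_inner_le_norm _ _
      _ ≤ 1 * (‖fderiv ℝ η x‖ * 1) := by
          rw [bb.norm_eq_one i]
          gcongr
          simpa [bb.norm_eq_one i] using (fderiv ℝ η x).le_opNorm (bb i)
      _ ≤ K₁ := by simpa using hK₁ x
  have cD : Continuous (fderiv ℝ η) := hη2.continuous_fderiv (by simp)
  have hK₁0 : 0 ≤ K₁ := (norm_nonneg _).trans (hK₁ 0)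
  have hK₂0 : 0 ≤ K₂ := (norm_nonneg _).trans (hK₂ 0)
  have hpi' := hpi
  rw [FunctionSpaces.AubinLions.volume_restrict_prod] at hpi'
  filter_upwards [hE, FunctionSpaces.AubinLions.ae_aestronglyMeasurable_slice hm, hpi'.prod_right_ae]
    with t hEt hut hpt
  have hpt' : Integrable (fun x => p t x) (volume.restrict (Ω : Set (EuclideanSpace ℝ (Fin 3)))) := hpt
  have hmu : MemLp (u t) 2 (volume.restrict (Ω : Set (EuclideanSpace ℝ (Fin 3)))) := NSCylinder.memLp_two_slice hC hut hEt
  have hiu : Integrable (u t) (volume.restrict (Ω : Set (EuclideanSpace ℝ (Fin 3)))) :=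
    memLp_one_iff_integrable.1 (hmu.mono_exponent one_le_two)
  have hiu2 : Integrable (fun x => ‖u t x‖ ^ 2) (volume.restrict (Ω : Set (EuclideanSpace ℝ (Fin 3)))) := by
    have h := hmu.integrable_norm_rpow two_ne_zero ENNReal.ofNat_ne_top
    refine h.congr (Eventually.of_forall fun x => ?_)
    simp only [ENNReal.toReal_ofNat, Real.rpow_two]
  have hE' : ∫ x in (Ω : Set (EuclideanSpace ℝ (Fin 3))), ‖u t x‖ ^ 2 ≤ C.toReal :=
    NSCylinder.integral_norm_sq_le_toReal hC hut hEt
  -- the three pieces and their integrability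
  have i1 : Integrable (fun x => ⟪u t x, fderiv ℝ η x (u t x)⟫) (volume.restrict (Ω : Set (EuclideanSpace ℝ (Fin 3)))) := by
    have hm1 : AEStronglyMeasurable (fun x => ⟪u t x, fderiv ℝ η x (u t x)⟫)
        (volume.restrict (Ω : Set (EuclideanSpace ℝ (Fin 3)))) :=
      hut.inner (isBoundedBilinearMap_apply.continuous.comp_aestronglyMeasurable
        (cD.aestronglyMeasurable.prodMk hut))
    refine Integrable.mono' (hiu2.const_mul K₁) hm1 (Eventually.of_forall fun x => ?_)
    calc ‖⟪u t x, fderiv ℝ η x (u t x)⟫‖ ≤ ‖u t x‖ * ‖fderiv ℝ η x (u t x)‖ := norm_inner_le_norm _ _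
      _ ≤ ‖u t x‖ * (K₁ * ‖u t x‖) := by
          gcongr
          exact (ContinuousLinearMap.le_opNorm _ _).trans
            (mul_le_mul_of_nonneg_right (hK₁ x) (norm_nonneg _))
      _ = K₁ * ‖u t x‖ ^ 2 := by ring
  have i2 : Integrable (fun x => ⟪u t x, Δ η x⟫) (volume.restrict (Ω : Set (EuclideanSpace ℝ (Fin 3)))) := by
    refine Integrable.mono' (hiu.norm.mul_const K₂)
      (hut.inner (continuous_laplacian hη2).aestronglyMeasurable) (Eventually.of_forall fun x => ?_)
    exact (norm_inner_le_norm _ _).trans (mul_le_mul_of_nonneg_left (hK₂ x) (norm_nonneg _))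
  have i3 : Integrable (fun x => p t x * VectorCalculus.divergence η x)
      (volume.restrict (Ω : Set (EuclideanSpace ℝ (Fin 3)))) := by
    have : (fun x => p t x * VectorCalculus.divergence η x) =
        fun x => VectorCalculus.divergence η x * p t x := by ext x; ring
    rw [this]
    exact hpt'.bdd_mul (continuous_divergence cD).aestronglyMeasurable
      (Eventually.of_forall fun x => hdivb x)
  -- the three bounds
  have b1 : ∫ x in (Ω : Set (EuclideanSpace ℝ (Fin 3))), ‖⟪u t x, fderiv ℝ η x (u t x)⟫‖ ≤ K₁ * C.toReal := by
    calc ∫ x in (Ω : Set (EuclideanSpace ℝ (Fin 3))), ‖⟪u t x, fderiv ℝ η x (u t x)⟫‖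
        ≤ ∫ x in (Ω : Set (EuclideanSpace ℝ (Fin 3))), K₁ * ‖u t x‖ ^ 2 := by
          refine integral_mono i1.norm (hiu2.const_mul K₁) fun x => ?_
          calc ‖⟪u t x, fderiv ℝ η x (u t x)⟫‖ ≤ ‖u t x‖ * ‖fderiv ℝ η x (u t x)‖ :=
                norm_inner_le_norm _ _
            _ ≤ ‖u t x‖ * (K₁ * ‖u t x‖) := by
                gcongr
                exact (ContinuousLinearMap.le_opNorm _ _).trans
                  (mul_le_mul_of_nonneg_right (hK₁ x) (norm_nonneg _))
            _ = K₁ * ‖u t x‖ ^ 2 := by ring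
      _ = K₁ * ∫ x in (Ω : Set (EuclideanSpace ℝ (Fin 3))), ‖u t x‖ ^ 2 := MeasureTheory.integral_const_mul _ _
      _ ≤ K₁ * C.toReal := mul_le_mul_of_nonneg_left hE' hK₁0
  have b2 : ∫ x in (Ω : Set (EuclideanSpace ℝ (Fin 3))), ‖⟪u t x, Δ η x⟫‖ ≤
      K₂ * ((volume (Ω : Set (EuclideanSpace ℝ (Fin 3)))).toReal + C.toReal) := by
    calc ∫ x in (Ω : Set (EuclideanSpace ℝ (Fin 3))), ‖⟪u t x, Δ η x⟫‖
        ≤ ∫ x in (Ω : Set (EuclideanSpace ℝ (Fin 3))), K₂ * (1 + ‖u t x‖ ^ 2) := by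
          refine integral_mono i2.norm (((integrable_const _).add hiu2).const_mul K₂) fun x => ?_
          calc ‖⟪u t x, Δ η x⟫‖ ≤ ‖u t x‖ * ‖Δ η x‖ := norm_inner_le_norm _ _
            _ ≤ (1 + ‖u t x‖ ^ 2) * K₂ :=
                mul_le_mul (NSCylinder.norm_le_one_add_sq _) (hK₂ x) (norm_nonneg _) (by positivity)
            _ = K₂ * (1 + ‖u t x‖ ^ 2) := mul_comm _ _
      _ = K₂ * ((volume (Ω : Set (EuclideanSpace ℝ (Fin 3)))).toReal + ∫ x in (Ω : Set (EuclideanSpace ℝ (Fin 3))), ‖u t x‖ ^ 2) := by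
          rw [MeasureTheory.integral_const_mul, integral_add (integrable_const _) hiu2,
            MeasureTheory.integral_const, measureReal_restrict_apply_univ, smul_eq_mul, mul_one,
            measureReal_def]
      _ ≤ K₂ * ((volume (Ω : Set (EuclideanSpace ℝ (Fin 3)))).toReal + C.toReal) := by gcongr
  have b3 : ∫ x in (Ω : Set (EuclideanSpace ℝ (Fin 3))), ‖p t x * VectorCalculus.divergence η x‖ ≤
      3 * K₁ * ∫ x in (Ω : Set (EuclideanSpace ℝ (Fin 3))), |p t x| := by
    calc ∫ x in (Ω : Set (EuclideanSpace ℝ (Fin 3))), ‖p t x * VectorCalculus.divergence η x‖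
        ≤ ∫ x in (Ω : Set (EuclideanSpace ℝ (Fin 3))), 3 * K₁ * |p t x| := by
          refine integral_mono i3.norm (hpt'.abs.const_mul _) fun x => ?_
          rw [norm_mul, Real.norm_eq_abs, mul_comm (3 * K₁)]
          exact mul_le_mul_of_nonneg_left (hdivb x) (abs_nonneg _)
      _ = 3 * K₁ * ∫ x in (Ω : Set (EuclideanSpace ℝ (Fin 3))), |p t x| := MeasureTheory.integral_const_mul _ _
  -- assemble
  calc |∫ x in (Ω : Set (EuclideanSpace ℝ (Fin 3))), (⟪u t x, fderiv ℝ η x (u t x)⟫ + ⟪u t x, Δ η x⟫ +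
          p t x * VectorCalculus.divergence η x)|
      ≤ ∫ x in (Ω : Set (EuclideanSpace ℝ (Fin 3))), ‖⟪u t x, fderiv ℝ η x (u t x)⟫ + ⟪u t x, Δ η x⟫ +
          p t x * VectorCalculus.divergence η x‖ := by
        rw [← Real.norm_eq_abs]; exact norm_integral_le_integral_norm _
    _ ≤ ∫ x in (Ω : Set (EuclideanSpace ℝ (Fin 3))), (‖⟪u t x, fderiv ℝ η x (u t x)⟫‖ + ‖⟪u t x, Δ η x⟫‖ +
          ‖p t x * VectorCalculus.divergence η x‖) :=
        integral_mono ((i1.add i2).add i3).norm ((i1.norm.add i2.norm).add i3.norm) fun x =>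
          (norm_add_le _ _).trans (add_le_add (norm_add_le _ _) le_rfl)
    _ = (∫ x in (Ω : Set (EuclideanSpace ℝ (Fin 3))), ‖⟪u t x, fderiv ℝ η x (u t x)⟫‖) +
          (∫ x in (Ω : Set (EuclideanSpace ℝ (Fin 3))), ‖⟪u t x, Δ η x⟫‖) +
          ∫ x in (Ω : Set (EuclideanSpace ℝ (Fin 3))), ‖p t x * VectorCalculus.divergence η x‖ := by
        have i12 : Integrable (fun x => ‖⟪u t x, fderiv ℝ η x (u t x)⟫‖ + ‖⟪u t x, Δ η x⟫‖)
            (volume.restrict (Ω : Set (EuclideanSpace ℝ (Fin 3)))) := i1.norm.add i2.norm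
        rw [integral_add i12 i3.norm, integral_add i1.norm i2.norm]
    _ ≤ K₁ * C.toReal + K₂ * ((volume (Ω : Set (EuclideanSpace ℝ (Fin 3)))).toReal + C.toReal) +
          3 * K₁ * ∫ x in (Ω : Set (EuclideanSpace ℝ (Fin 3))), |p t x| := add_le_add (add_le_add b1 b2) b3

/-- **Hölder in time for the pressure slices.** If `∫∫_W |p|^{3/2} ≤ C_p` on `W = (a, b) × Ω`,
then for `a < s ≤ t < b`,
`∫_s^t ∫_Ω |p| ≤ (t - s)^{1/3} (|Ω|^{1/2} C_p)^{2/3}` (Hölder in `x` with exponents `(3, 3/2)`,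
then in `t`). [folklore] -/
theorem NSCylinder.setIntegral_pressureSlice_le (hbΩ : IsBounded (Ω : Set (EuclideanSpace ℝ (Fin 3))))
    (hpm : AEStronglyMeasurable (uncurry p) (volume.restrict (Ioo a b ×ˢ (Ω : Set (EuclideanSpace ℝ (Fin 3))))))
    (hpi : Integrable (uncurry p) (volume.restrict (Ioo a b ×ˢ (Ω : Set (EuclideanSpace ℝ (Fin 3))))))
    {Cp : ℝ≥0∞} (hCp : Cp ≠ ⊤)
    (hP : ∫⁻ z in Ioo a b ×ˢ (Ω : Set (EuclideanSpace ℝ (Fin 3))), ‖p z.1 z.2‖ₑ ^ (3 / 2 : ℝ) ≤ Cp)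
    {s t : ℝ} (has : a < s) (hst : s ≤ t) (htb : t < b) :
    ∫ τ in Ioc s t, ∫ x in (Ω : Set (EuclideanSpace ℝ (Fin 3))), |p τ x| ≤
      (t - s) ^ (1 / 3 : ℝ) *
        (((volume (Ω : Set (EuclideanSpace ℝ (Fin 3)))) ^ (1 / 2 : ℝ) * Cp) ^ (2 / 3 : ℝ)).toReal := by
  have hΩfin : volume (Ω : Set (EuclideanSpace ℝ (Fin 3))) < ⊤ :=
    (measure_mono subset_closure).trans_lt hbΩ.isCompact_closure.measure_lt_top
  have hsub : Ioc s t ⊆ Ioo a b := fun x hx => ⟨has.trans hx.1, hx.2.trans_lt htb⟩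
  have hpm' := hpm
  have hpi' := hpi
  rw [FunctionSpaces.AubinLions.volume_restrict_prod] at hpm' hpi'
  -- the `ℝ≥0∞` pressure slice `Q τ = ∫_Ω ‖p τ‖ₑ`
  have hQm : AEMeasurable (fun τ => ∫⁻ x in (Ω : Set (EuclideanSpace ℝ (Fin 3))), ‖p τ x‖ₑ) (volume.restrict (Ioo a b)) :=
    hpm'.enorm.lintegral_prod_right'
  have hQfin : ∀ᵐ τ ∂(volume.restrict (Ioo a b)), ∫⁻ x in (Ω : Set (EuclideanSpace ℝ (Fin 3))), ‖p τ x‖ₑ < ⊤ := by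
    filter_upwards [hpi'.prod_right_ae] with τ hτ
    exact hτ.2
  have hq : ∀ᵐ τ ∂(volume.restrict (Ioo a b)),
      (∫ x in (Ω : Set (EuclideanSpace ℝ (Fin 3))), |p τ x|) = (∫⁻ x in (Ω : Set (EuclideanSpace ℝ (Fin 3))), ‖p τ x‖ₑ).toReal := by
    filter_upwards [hpi'.prod_right_ae] with τ hτ
    have h := integral_norm_eq_lintegral_enorm hτ.1
    simpa only [Real.norm_eq_abs, Function.uncurry_apply_pair] using h
  -- pass to `ℝ≥0∞`
  have hq' : ∀ᵐ τ ∂(volume.restrict (Ioc s t)),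
      (∫ x in (Ω : Set (EuclideanSpace ℝ (Fin 3))), |p τ x|) = (∫⁻ x in (Ω : Set (EuclideanSpace ℝ (Fin 3))), ‖p τ x‖ₑ).toReal :=
    ae_restrict_of_ae_restrict_of_subset hsub hq
  rw [integral_congr_ae hq', integral_toReal (hQm.mono_set hsub)
    (ae_restrict_of_ae_restrict_of_subset hsub hQfin)]
  -- Hölder in time
  have hpq : Real.HolderConjugate 3 (3 / 2) := ⟨by norm_num, by norm_num, by norm_num⟩
  have hH := ENNReal.lintegral_mul_le_Lp_mul_Lq (volume.restrict (Ioc s t)) hpq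
    aemeasurable_const (hQm.mono_set hsub) (f := fun _ => 1)
  have hone : ∫⁻ _ in Ioc s t, (1 : ℝ≥0∞) ^ (3 : ℝ) = ENNReal.ofReal (t - s) := by
    simp [Real.volume_Ioc]
  simp only [Pi.mul_apply, one_mul] at hH
  rw [hone] at hH
  -- Hölder in space, slice-wise: `Q τ ^ {3/2} ≤ |Ω|^{1/2} ∫_Ω ‖p τ‖ₑ^{3/2}`
  have hpq' : Real.HolderConjugate 3 (3 / 2) := hpq
  have hslice : ∀ᵐ τ ∂(volume.restrict (Ioo a b)),
      (∫⁻ x in (Ω : Set (EuclideanSpace ℝ (Fin 3))), ‖p τ x‖ₑ) ^ (3 / 2 : ℝ) ≤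
        (volume (Ω : Set (EuclideanSpace ℝ (Fin 3)))) ^ (1 / 2 : ℝ) * ∫⁻ x in (Ω : Set (EuclideanSpace ℝ (Fin 3))), ‖p τ x‖ₑ ^ (3 / 2 : ℝ) := by
    filter_upwards [FunctionSpaces.AubinLions.ae_aestronglyMeasurable_slice
      (f := uncurry p) hpm] with τ hτ
    have hτ' : AEStronglyMeasurable (fun x => p τ x) (volume.restrict (Ω : Set (EuclideanSpace ℝ (Fin 3)))) := hτ
    have h := ENNReal.lintegral_mul_le_Lp_mul_Lq (volume.restrict (Ω : Set (EuclideanSpace ℝ (Fin 3)))) hpq'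
      aemeasurable_const hτ'.enorm (f := fun _ => 1)
    simp only [Pi.mul_apply, one_mul, ENNReal.one_rpow, lintegral_const,
      Measure.restrict_apply_univ, one_div] at h
    calc (∫⁻ x in (Ω : Set (EuclideanSpace ℝ (Fin 3))), ‖p τ x‖ₑ) ^ (3 / 2 : ℝ)
        ≤ ((volume (Ω : Set (EuclideanSpace ℝ (Fin 3)))) ^ (3 : ℝ)⁻¹ *
            (∫⁻ x in (Ω : Set (EuclideanSpace ℝ (Fin 3))), ‖p τ x‖ₑ ^ (3 / 2 : ℝ)) ^ (3 / 2 : ℝ)⁻¹) ^ (3 / 2 : ℝ) :=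
          ENNReal.rpow_le_rpow h (by norm_num)
      _ = (volume (Ω : Set (EuclideanSpace ℝ (Fin 3)))) ^ (1 / 2 : ℝ) * ∫⁻ x in (Ω : Set (EuclideanSpace ℝ (Fin 3))), ‖p τ x‖ₑ ^ (3 / 2 : ℝ) := by
          rw [ENNReal.mul_rpow_of_nonneg _ _ (by norm_num), ← ENNReal.rpow_mul, ← ENNReal.rpow_mul]
          norm_num
  have hint : ∫⁻ τ in Ioc s t, (∫⁻ x in (Ω : Set (EuclideanSpace ℝ (Fin 3))), ‖p τ x‖ₑ) ^ (3 / 2 : ℝ) ≤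
      (volume (Ω : Set (EuclideanSpace ℝ (Fin 3)))) ^ (1 / 2 : ℝ) * Cp := by
    calc ∫⁻ τ in Ioc s t, (∫⁻ x in (Ω : Set (EuclideanSpace ℝ (Fin 3))), ‖p τ x‖ₑ) ^ (3 / 2 : ℝ)
        ≤ ∫⁻ τ in Ioo a b, (∫⁻ x in (Ω : Set (EuclideanSpace ℝ (Fin 3))), ‖p τ x‖ₑ) ^ (3 / 2 : ℝ) :=
          lintegral_mono_set hsub
      _ ≤ ∫⁻ τ in Ioo a b, (volume (Ω : Set (EuclideanSpace ℝ (Fin 3)))) ^ (1 / 2 : ℝ) *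
            ∫⁻ x in (Ω : Set (EuclideanSpace ℝ (Fin 3))), ‖p τ x‖ₑ ^ (3 / 2 : ℝ) := lintegral_mono_ae hslice
      _ = (volume (Ω : Set (EuclideanSpace ℝ (Fin 3)))) ^ (1 / 2 : ℝ) *
            ∫⁻ τ in Ioo a b, ∫⁻ x in (Ω : Set (EuclideanSpace ℝ (Fin 3))), ‖p τ x‖ₑ ^ (3 / 2 : ℝ) := by
          have hIm : AEMeasurable (fun τ => ∫⁻ x in (Ω : Set (EuclideanSpace ℝ (Fin 3))), ‖p τ x‖ₑ ^ (3 / 2 : ℝ))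
              (volume.restrict (Ioo a b)) := (hpm'.enorm.pow_const _).lintegral_prod_right'
          rw [lintegral_const_mul'' _ hIm]
      _ = (volume (Ω : Set (EuclideanSpace ℝ (Fin 3)))) ^ (1 / 2 : ℝ) *
            ∫⁻ z in Ioo a b ×ˢ (Ω : Set (EuclideanSpace ℝ (Fin 3))), ‖p z.1 z.2‖ₑ ^ (3 / 2 : ℝ) := by
          have hzm : AEMeasurable (fun z : ℝ × (EuclideanSpace ℝ (Fin 3)) => ‖p z.1 z.2‖ₑ ^ (3 / 2 : ℝ))
              (((volume : Measure ℝ).restrict (Ioo a b)).prod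
                ((volume : Measure (EuclideanSpace ℝ (Fin 3))).restrict (Ω : Set (EuclideanSpace ℝ (Fin 3))))) := hpm'.enorm.pow_const _
          rw [FunctionSpaces.AubinLions.volume_restrict_prod, lintegral_prod _ hzm]
      _ ≤ (volume (Ω : Set (EuclideanSpace ℝ (Fin 3)))) ^ (1 / 2 : ℝ) * Cp := mul_le_mul' le_rfl hP
  -- assemble in `ℝ≥0∞`, then pass to `ℝ`
  have hB : ∫⁻ τ in Ioc s t, ∫⁻ x in (Ω : Set (EuclideanSpace ℝ (Fin 3))), ‖p τ x‖ₑ ≤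
      ENNReal.ofReal (t - s) ^ (1 / 3 : ℝ) *
        ((volume (Ω : Set (EuclideanSpace ℝ (Fin 3)))) ^ (1 / 2 : ℝ) * Cp) ^ (2 / 3 : ℝ) := by
    refine hH.trans ?_
    have e1 : (1 : ℝ) / 3 = (1 / 3 : ℝ) := rfl
    have e2 : (1 : ℝ) / (3 / 2) = (2 / 3 : ℝ) := by norm_num
    rw [e2]
    gcongr
  have hfin : ENNReal.ofReal (t - s) ^ (1 / 3 : ℝ) *
      ((volume (Ω : Set (EuclideanSpace ℝ (Fin 3)))) ^ (1 / 2 : ℝ) * Cp) ^ (2 / 3 : ℝ) ≠ ⊤ :=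
    ENNReal.mul_ne_top (ENNReal.rpow_ne_top_of_nonneg (by norm_num) ENNReal.ofReal_ne_top)
      (ENNReal.rpow_ne_top_of_nonneg (by norm_num)
        (ENNReal.mul_ne_top (ENNReal.rpow_ne_top_of_nonneg (by norm_num) hΩfin.ne) hCp))
  calc (∫⁻ τ in Ioc s t, ∫⁻ x in (Ω : Set (EuclideanSpace ℝ (Fin 3))), ‖p τ x‖ₑ).toReal
      ≤ (ENNReal.ofReal (t - s) ^ (1 / 3 : ℝ) *
          ((volume (Ω : Set (EuclideanSpace ℝ (Fin 3)))) ^ (1 / 2 : ℝ) * Cp) ^ (2 / 3 : ℝ)).toReal := ENNReal.toReal_mono hfin hB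
    _ = (t - s) ^ (1 / 3 : ℝ) *
          (((volume (Ω : Set (EuclideanSpace ℝ (Fin 3)))) ^ (1 / 2 : ℝ) * Cp) ^ (2 / 3 : ℝ)).toReal := by
        rw [ENNReal.toReal_mul, ← ENNReal.toReal_rpow, ENNReal.toReal_ofReal (by linarith)]

/-- **Modulus of continuity of the pairings, up to a null set of times.** Let `(u, p)` be a
distributional solution of Navier–Stokes (`ν = 1`, no force) in `W = (a, b) × Ω`, `Ω` bounded,
with `∫_Ω ‖u(t)‖² ≤ C` for a.e. `t` and `∫∫_W |p|^{3/2} ≤ C_p`, and let `η` be a test field on `Ω`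
with `‖Dη‖ ≤ K₁`, `‖Δη‖ ≤ K₂`. Then there is a full-measure set `S ⊆ (a, b)` of times such that
for all `t, s ∈ S`,
`|∫_Ω ⟪u(t), η⟫ - ∫_Ω ⟪u(s), η⟫| ≤ A |t - s| + B |t - s|^{1/3}`,
`A = K₁ C + K₂ (|Ω| + C)`, `B = 3 K₁ (|Ω|^{1/2} C_p)^{2/3}` — a modulus depending on the solution
only through the constants `C`, `C_p` (the weak time regularity `∂ₜu ∈ L^{q}_t H^{-s}_x` of weak
solutions, in the pairing form; Temam 1977/79, Ch. III, §3, (3.40)–(3.43); Robinson–Rodrigo–Sadowski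
2016, Lemma 13.8 is the bounded case treated in `NSSliceTimeIncrement`). [folklore] -/
theorem NSCylinder.exists_fullMeasure_pairing_modulus
    (hsol : IsDistributionalNSSolutionOn (timeCylinder Ω a b) 1 0 u p)
    (hbΩ : IsBounded (Ω : Set (EuclideanSpace ℝ (Fin 3)))) {C Cp : ℝ≥0∞} (hC : C ≠ ⊤) (hCp : Cp ≠ ⊤)
    (hE : ∀ᵐ t ∂(volume.restrict (Ioo a b)), ∫⁻ x in (Ω : Set (EuclideanSpace ℝ (Fin 3))), ‖u t x‖ₑ ^ 2 ≤ C)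
    (hP : ∫⁻ z in Ioo a b ×ˢ (Ω : Set (EuclideanSpace ℝ (Fin 3))), ‖p z.1 z.2‖ₑ ^ (3 / 2 : ℝ) ≤ Cp)
    {η : (EuclideanSpace ℝ (Fin 3)) → (EuclideanSpace ℝ (Fin 3))} (hη : FunctionSpaces.IsTestFunctionOn Ω η) {K₁ K₂ : ℝ}
    (hK₁ : ∀ x, ‖fderiv ℝ η x‖ ≤ K₁) (hK₂ : ∀ x, ‖Δ η x‖ ≤ K₂) :
    ∃ S : Set ℝ, (∀ᵐ t ∂(volume.restrict (Ioo a b)), t ∈ S) ∧ ∀ t ∈ S, ∀ s ∈ S,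
      |(∫ x in (Ω : Set (EuclideanSpace ℝ (Fin 3))), ⟪u t x, η x⟫) - ∫ x in (Ω : Set (EuclideanSpace ℝ (Fin 3))), ⟪u s x, η x⟫| ≤
        (K₁ * C.toReal + K₂ * ((volume (Ω : Set (EuclideanSpace ℝ (Fin 3)))).toReal + C.toReal)) * |t - s| +
          3 * K₁ * (((volume (Ω : Set (EuclideanSpace ℝ (Fin 3)))) ^ (1 / 2 : ℝ) * Cp) ^ (2 / 3 : ℝ)).toReal *
            |t - s| ^ (1 / 3 : ℝ) := by
  have hm : AEStronglyMeasurable (uncurry u) (volume.restrict (Ioo a b ×ˢ (Ω : Set (EuclideanSpace ℝ (Fin 3))))) :=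
    hsol.1.aestronglyMeasurable
  have hpm : AEStronglyMeasurable (uncurry p) (volume.restrict (Ioo a b ×ˢ (Ω : Set (EuclideanSpace ℝ (Fin 3))))) :=
    hsol.2.2.1.aestronglyMeasurable
  -- `u ∈ L²(W)` and `p ∈ L¹(W)`
  have hu2 : ∫⁻ z in Ioo a b ×ˢ (Ω : Set (EuclideanSpace ℝ (Fin 3))), ‖u z.1 z.2‖ₑ ^ 2 < ∞ := by
    have h := FunctionSpaces.AubinLions.lintegral_sq_eq_lintegral_slice hm
    calc ∫⁻ z in Ioo a b ×ˢ (Ω : Set (EuclideanSpace ℝ (Fin 3))), ‖u z.1 z.2‖ₑ ^ 2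
        = ∫⁻ t in Ioo a b, ∫⁻ x in (Ω : Set (EuclideanSpace ℝ (Fin 3))), ‖u t x‖ₑ ^ 2 := h
      _ ≤ ∫⁻ _ in Ioo a b, C := lintegral_mono_ae hE
      _ < ∞ := by
          rw [lintegral_const, Measure.restrict_apply_univ]
          exact ENNReal.mul_lt_top hC.lt_top measure_Ioo_lt_top
  have hPfin : ∫⁻ z in Ioo a b ×ˢ (Ω : Set (EuclideanSpace ℝ (Fin 3))), ‖p z.1 z.2‖ₑ ^ (3 / 2 : ℝ) < ∞ :=
    hP.trans_lt hCp.lt_top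
  have hpi := NSCylinder.integrable_pressure_of_lintegral_rpow hbΩ hpm hPfin
  -- the primitive representation and the remainder
  obtain ⟨c, hc⟩ := NSCylinder.exists_ae_pairing_eq_const_add_primitive hsol hbΩ hu2 hpi hη
  obtain ⟨K₀, K₁', K₂', hK₀, -, -⟩ := exists_bounds_of_isTestFunctionOn hη
  have hη2 : ContDiff ℝ 2 η := hη.contDiff.of_le (by norm_cast)
  have hu := NSCylinder.integrable_of_lintegral_sq hbΩ hm hu2
  have hu2' := NSCylinder.integrable_norm_sq_of_lintegral_sq hm hu2
  have iG := NSCylinder.integrable_remainder_test hu hu2' hpi hη2 hK₁ hK₂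
  have hpi' := hpi
  rw [FunctionSpaces.AubinLions.volume_restrict_prod] at iG hpi'
  have hFi : IntegrableOn (fun τ => ∫ x in (Ω : Set (EuclideanSpace ℝ (Fin 3))), (⟪u τ x, fderiv ℝ η x (u τ x)⟫ +
      ⟪u τ x, Δ η x⟫ + p τ x * VectorCalculus.divergence η x)) (Ioo a b) volume :=
    iG.integral_prod_left
  have hqi : IntegrableOn (fun τ => ∫ x in (Ω : Set (EuclideanSpace ℝ (Fin 3))), |p τ x|) (Ioo a b) volume := by
    have h := hpi'.integral_norm_prod_left
    simp only [Real.norm_eq_abs, Function.uncurry_apply_pair] at h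
    exact h
  have hR := NSCylinder.ae_abs_remainder_le hbΩ hm hC hE hpi hη2 hK₁ hK₂
  -- abbreviations for the constants
  set A : ℝ := K₁ * C.toReal + K₂ * ((volume (Ω : Set (EuclideanSpace ℝ (Fin 3)))).toReal + C.toReal) with hA
  set B : ℝ := (((volume (Ω : Set (EuclideanSpace ℝ (Fin 3)))) ^ (1 / 2 : ℝ) * Cp) ^ (2 / 3 : ℝ)).toReal with hB
  have hK₁0 : 0 ≤ K₁ := (norm_nonneg _).trans (hK₁ 0)
  have hB0 : 0 ≤ B := ENNReal.toReal_nonneg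
  -- the good set
  refine ⟨{t | t ∈ Ioo a b ∧ (∫ x in (Ω : Set (EuclideanSpace ℝ (Fin 3))), ⟪u t x, η x⟫) = c + ∫ s in Ioc a t,
      ∫ x in (Ω : Set (EuclideanSpace ℝ (Fin 3))), (⟪u s x, fderiv ℝ η x (u s x)⟫ + ⟪u s x, Δ η x⟫ +
        p s x * VectorCalculus.divergence η x)}, ?_, ?_⟩
  · filter_upwards [ae_restrict_mem measurableSet_Ioo, hc] with t ht htc
    exact ⟨ht, htc⟩
  -- the increment bound for `s ≤ t`
  have key : ∀ t ∈ Ioo a b, ∀ s ∈ Ioo a b, s ≤ t →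
      |(∫ τ in Ioc a t, ∫ x in (Ω : Set (EuclideanSpace ℝ (Fin 3))), (⟪u τ x, fderiv ℝ η x (u τ x)⟫ + ⟪u τ x, Δ η x⟫ +
          p τ x * VectorCalculus.divergence η x)) -
        ∫ τ in Ioc a s, ∫ x in (Ω : Set (EuclideanSpace ℝ (Fin 3))), (⟪u τ x, fderiv ℝ η x (u τ x)⟫ + ⟪u τ x, Δ η x⟫ +
          p τ x * VectorCalculus.divergence η x)| ≤
        A * (t - s) + 3 * K₁ * B * (t - s) ^ (1 / 3 : ℝ) := by
    intro t ht s hs hst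
    have hsub_t : Ioc a t ⊆ Ioo a b := fun x hx => ⟨hx.1, hx.2.trans_lt ht.2⟩
    have hsub_st : Ioc s t ⊆ Ioo a b := fun x hx => ⟨hs.1.trans hx.1, hx.2.trans_lt ht.2⟩
    have hunion : Ioc a t = Ioc a s ∪ Ioc s t := (Ioc_union_Ioc_eq_Ioc hs.1.le hst).symm
    have hdisj : Disjoint (Ioc a s) (Ioc s t) := Ioc_disjoint_Ioc_of_le le_rfl
    rw [hunion, setIntegral_union hdisj measurableSet_Ioc
      (hFi.mono_set (fun x hx => ⟨hx.1, hx.2.trans_lt hs.2⟩)) (hFi.mono_set hsub_st)]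
    simp only [add_sub_cancel_left]
    calc |∫ τ in Ioc s t, ∫ x in (Ω : Set (EuclideanSpace ℝ (Fin 3))), (⟪u τ x, fderiv ℝ η x (u τ x)⟫ + ⟪u τ x, Δ η x⟫ +
            p τ x * VectorCalculus.divergence η x)|
        ≤ ∫ τ in Ioc s t, |∫ x in (Ω : Set (EuclideanSpace ℝ (Fin 3))), (⟪u τ x, fderiv ℝ η x (u τ x)⟫ + ⟪u τ x, Δ η x⟫ +
            p τ x * VectorCalculus.divergence η x)| := by
          simpa only [← Real.norm_eq_abs] using MeasureTheory.norm_integral_le_integral_norm _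
      _ ≤ ∫ τ in Ioc s t, (A + 3 * K₁ * ∫ x in (Ω : Set (EuclideanSpace ℝ (Fin 3))), |p τ x|) := by
          refine integral_mono_ae (hFi.mono_set hsub_st).abs
            ((integrable_const A).add ((hqi.mono_set hsub_st).const_mul _)) ?_
          exact ae_restrict_of_ae_restrict_of_subset hsub_st hR
      _ = A * (t - s) + 3 * K₁ * ∫ τ in Ioc s t, ∫ x in (Ω : Set (EuclideanSpace ℝ (Fin 3))), |p τ x| := by
          rw [integral_add (integrable_const A) ((hqi.mono_set hsub_st).const_mul _),
            MeasureTheory.integral_const, measureReal_restrict_apply_univ,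
            Real.volume_real_Ioc_of_le hst, smul_eq_mul, MeasureTheory.integral_const_mul,
            mul_comm (t - s) A]
      _ ≤ A * (t - s) + 3 * K₁ * ((t - s) ^ (1 / 3 : ℝ) * B) :=
          add_le_add le_rfl (mul_le_mul_of_nonneg_left
            (NSCylinder.setIntegral_pressureSlice_le hbΩ hpm hpi hCp hP hs.1 hst ht.2)
            (mul_nonneg (by norm_num) hK₁0))
      _ = A * (t - s) + 3 * K₁ * B * (t - s) ^ (1 / 3 : ℝ) := by ring
  rintro t ⟨ht, htc⟩ s ⟨hs, hsc⟩
  rw [htc, hsc, add_sub_add_left_eq_sub]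
  rcases le_total s t with hst | hts
  · have e : |t - s| = t - s := abs_of_nonneg (sub_nonneg.2 hst)
    rw [e]
    exact key t ht s hs hst
  · have e : |t - s| = s - t := by rw [abs_sub_comm]; exact abs_of_nonneg (sub_nonneg.2 hts)
    rw [e, abs_sub_comm]
    exact key s hs t ht hts

end Modulus

/-! ### Vector pairings with scalar test functions, and the packaged compactness theorem -/

section Package

/-- A scalar test function on `Ω` times a fixed vector is a test field on `Ω`. [folklore] -/
theorem NSCylinder.isTestFunctionOn_smul_const {Ω : Opens (EuclideanSpace ℝ (Fin 3))} {φ : (EuclideanSpace ℝ (Fin 3)) → ℝ}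
    (hφ : FunctionSpaces.IsTestFunctionOn Ω φ) (e : (EuclideanSpace ℝ (Fin 3))) :
    FunctionSpaces.IsTestFunctionOn Ω (fun x => φ x • e) :=
  ⟨hφ.contDiff.smul contDiff_const, hφ.hasCompactSupport.smul_right,
    (tsupport_smul_subset_left φ fun _ => e).trans hφ.tsupport_subset⟩

/-- The components of the vector pairing `∫_Ω φ • v` are the scalar pairings with the test fields
`φ e`: `⟪∫_Ω φ • v, e⟫ = ∫_Ω ⟪v, φ e⟫`. [folklore] -/
theorem NSCylinder.inner_integral_smul_eq {Ω : Opens (EuclideanSpace ℝ (Fin 3))} {v : (EuclideanSpace ℝ (Fin 3)) → (EuclideanSpace ℝ (Fin 3))} {φ : (EuclideanSpace ℝ (Fin 3)) → ℝ}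
    (hint : Integrable (fun x => φ x • v x) (volume.restrict (Ω : Set (EuclideanSpace ℝ (Fin 3))))) (e : (EuclideanSpace ℝ (Fin 3))) :
    ⟪∫ x in (Ω : Set (EuclideanSpace ℝ (Fin 3))), φ x • v x, e⟫ = ∫ x in (Ω : Set (EuclideanSpace ℝ (Fin 3))), ⟪v x, φ x • e⟫ := by
  rw [real_inner_comm, ← integral_inner hint e]
  refine integral_congr_ae (Eventually.of_forall fun x => ?_)
  simp only [real_inner_smul_right, real_inner_comm]

/-- `∫ ‖G‖ₑ² ≤ ∫ |G|²_F ≤ C_g`: the operator-norm dissipation is bounded by the Frobenius one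
(`‖L‖ ≤ |L|_F`: expand in the orthonormal frame and use Cauchy–Schwarz; cf. the tree's
`opNorm_le_sqrt_frobeniusNormSq` in `NSWeakStrongUniquenessProofs`, another import layer).
[folklore] -/
theorem NSCylinder.lintegral_enorm_sq_le_of_frobenius
    {G : ℝ → (EuclideanSpace ℝ (Fin 3)) → (EuclideanSpace ℝ (Fin 3)) →L[ℝ] (EuclideanSpace ℝ (Fin 3))}
    {μ : Measure (ℝ × (EuclideanSpace ℝ (Fin 3)))} {Cg : ℝ≥0∞}
    (h : ∫⁻ z, ENNReal.ofReal (frobeniusNormSq (G z.1 z.2)) ∂μ ≤ Cg) :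
    ∫⁻ z, ‖G z.1 z.2‖ₑ ^ 2 ∂μ ≤ Cg := by
  -- `‖L‖ₑ² ≤ ofReal |L|²_F` for every `L`
  have hL : ∀ L : (EuclideanSpace ℝ (Fin 3)) →L[ℝ] (EuclideanSpace ℝ (Fin 3)),
      ‖L‖ₑ ^ 2 ≤ ENNReal.ofReal (frobeniusNormSq L) := by
    intro L
    have hop : ‖L‖ ≤ Real.sqrt (frobeniusNormSq L) := by
      refine ContinuousLinearMap.opNorm_le_bound _ (Real.sqrt_nonneg _) fun v => ?_
      have hv : L v = ∑ i, ⟪stdOrthonormalBasis ℝ (EuclideanSpace ℝ (Fin 3)) i, v⟫ •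
          L (stdOrthonormalBasis ℝ (EuclideanSpace ℝ (Fin 3)) i) := by
        conv_lhs => rw [← (stdOrthonormalBasis ℝ (EuclideanSpace ℝ (Fin 3))).sum_repr' v]
        simp [map_sum, map_smul]
      have hCS := Finset.sum_mul_sq_le_sq_mul_sq Finset.univ
        (fun i => |⟪stdOrthonormalBasis ℝ (EuclideanSpace ℝ (Fin 3)) i, v⟫|)
        (fun i => ‖L (stdOrthonormalBasis ℝ (EuclideanSpace ℝ (Fin 3)) i)‖)
      have hpar : ∑ i, |⟪stdOrthonormalBasis ℝ (EuclideanSpace ℝ (Fin 3)) i, v⟫| ^ 2 = ‖v‖ ^ 2 := by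
        rw [← (stdOrthonormalBasis ℝ (EuclideanSpace ℝ (Fin 3))).sum_sq_norm_inner_right v]
        simp [Real.norm_eq_abs]
      have hfrob : ∑ i, ‖L (stdOrthonormalBasis ℝ (EuclideanSpace ℝ (Fin 3)) i)‖ ^ 2 =
          frobeniusNormSq L := rfl
      calc ‖L v‖ = ‖∑ i, ⟪stdOrthonormalBasis ℝ (EuclideanSpace ℝ (Fin 3)) i, v⟫ •
              L (stdOrthonormalBasis ℝ (EuclideanSpace ℝ (Fin 3)) i)‖ := by rw [hv]
        _ ≤ ∑ i, ‖⟪stdOrthonormalBasis ℝ (EuclideanSpace ℝ (Fin 3)) i, v⟫ •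
              L (stdOrthonormalBasis ℝ (EuclideanSpace ℝ (Fin 3)) i)‖ := norm_sum_le _ _
        _ = ∑ i, |⟪stdOrthonormalBasis ℝ (EuclideanSpace ℝ (Fin 3)) i, v⟫| *
              ‖L (stdOrthonormalBasis ℝ (EuclideanSpace ℝ (Fin 3)) i)‖ := by simp [norm_smul]
        _ ≤ Real.sqrt ((∑ i, |⟪stdOrthonormalBasis ℝ (EuclideanSpace ℝ (Fin 3)) i, v⟫| ^ 2) *
              ∑ i, ‖L (stdOrthonormalBasis ℝ (EuclideanSpace ℝ (Fin 3)) i)‖ ^ 2) :=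
            (le_abs_self _).trans (Real.abs_le_sqrt hCS)
        _ = Real.sqrt (frobeniusNormSq L) * ‖v‖ := by
            rw [hpar, hfrob, mul_comm, Real.sqrt_mul (frobeniusNormSq_nonneg L),
              Real.sqrt_sq (norm_nonneg _)]
    have h2 : ‖L‖ ^ 2 ≤ frobeniusNormSq L := by
      calc ‖L‖ ^ 2 ≤ Real.sqrt (frobeniusNormSq L) ^ 2 := pow_le_pow_left₀ (norm_nonneg _) hop 2
        _ = frobeniusNormSq L := Real.sq_sqrt (frobeniusNormSq_nonneg L)
    calc ‖L‖ₑ ^ 2 = ENNReal.ofReal (‖L‖ ^ 2) := by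
          rw [← ofReal_norm, ENNReal.ofReal_pow (norm_nonneg _)]
      _ ≤ ENNReal.ofReal (frobeniusNormSq L) := ENNReal.ofReal_le_ofReal h2
  refine le_trans (lintegral_mono fun z => ?_) h
  exact hL (G z.1 z.2)

/-- **Strong `L²` compactness of the velocities on a cylinder.** Let `Ω ⊆ ℝ³` be a bounded
Lipschitz domain (e.g. a ball) and `(v_k, π_k)` distributional solutions of the Navier–Stokes
equations (`ν = 1`, no force) on the cylinder `W = (a, b) × Ω` with, uniformly in `k`,
* `∫_Ω ‖v_k(t)‖² ≤ C` for a.e. `t ∈ (a, b)` (`L^∞_t L²_x`),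
* weak spatial gradients `∇v_k` on `W` with `∫∫_W |∇v_k|² ≤ C_g` (`L²_t H¹_x`),
* `∫∫_W |π_k|^{3/2} ≤ C_p`.
Then a subsequence `v_{σ i}` converges **strongly in `L²(W)`** to a jointly measurable field `u`
with `∫_Ω ‖u(t)‖² ≤ C` for a.e. `t`, and for every real test function `φ` on `Ω` the slice pairings
`∫_Ω φ • v_{σ i}(t)` converge to `∫_Ω φ • u(t)` for a.e. `t`. This is the velocity half of the
compactness of (suitable) weak solutions on a cylinder — "`v_k` converges to `v` … in
`L²(0,T;L²(B₁))`" (Bradshaw–Tsai 2019, §4.3; Lin 1998, Thm. 2.2; Caffarelli–Kohn–Nirenberg 1982;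
Lemarié-Rieusset 2016, Thm. 12.1–12.2): the momentum equation gives the equicontinuity of the
pairings up to null sets (`NSCylinder.exists_fullMeasure_pairing_modulus`), and the generic
Aubin–Lions theorem `AubinLions.exists_subseq_strong_limit_of_equicontinuous` (Ehrling's lemma,
Rellich–Kondrachov) does the rest. [cite: BradshawTsai2019, §4.3 (proof of Thm 1.2), "vₖ converges to v … in L²(0,T;L²(B₁))"] [cite: Lemarierieusset2016, Thm. 12.1 (Rellich–Lions)] -/
theorem NSCylinder.exists_subseq_strong_limit_velocity {Ω : Opens (EuclideanSpace ℝ (Fin 3))}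
    (hΩ : FunctionSpaces.IsLipschitzDomain Ω) (hbΩ : IsBounded (Ω : Set (EuclideanSpace ℝ (Fin 3)))) {a b : ℝ}
    {v : ℕ → ℝ → (EuclideanSpace ℝ (Fin 3)) → (EuclideanSpace ℝ (Fin 3))} {π : ℕ → ℝ → (EuclideanSpace ℝ (Fin 3)) → ℝ} {C Cg Cp : ℝ≥0∞}
    (hC : C ≠ ⊤) (hCg : Cg ≠ ⊤) (hCp : Cp ≠ ⊤)
    (hsol : ∀ k, IsDistributionalNSSolutionOn (timeCylinder Ω a b) 1 0 (v k) (π k))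
    (hE : ∀ k, ∀ᵐ t ∂(volume.restrict (Ioo a b)), ∫⁻ x in (Ω : Set (EuclideanSpace ℝ (Fin 3))), ‖v k t x‖ₑ ^ 2 ≤ C)
    (hG : ∀ k, ∃ G : ℝ → (EuclideanSpace ℝ (Fin 3)) → (EuclideanSpace ℝ (Fin 3)) →L[ℝ] (EuclideanSpace ℝ (Fin 3)),
      HasWeakSpatialGradientOn (timeCylinder Ω a b) (v k) G ∧
      ∫⁻ z in Ioo a b ×ˢ (Ω : Set (EuclideanSpace ℝ (Fin 3))), ENNReal.ofReal (frobeniusNormSq (G z.1 z.2)) ≤ Cg)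
    (hP : ∀ k, ∫⁻ z in Ioo a b ×ˢ (Ω : Set (EuclideanSpace ℝ (Fin 3))), ‖π k z.1 z.2‖ₑ ^ (3 / 2 : ℝ) ≤ Cp) :
    ∃ (σ : ℕ → ℕ) (u : ℝ → (EuclideanSpace ℝ (Fin 3)) → (EuclideanSpace ℝ (Fin 3))), StrictMono σ ∧
      AEStronglyMeasurable (uncurry u) (volume.restrict (Ioo a b ×ˢ (Ω : Set (EuclideanSpace ℝ (Fin 3))))) ∧
      (∀ᵐ t ∂(volume.restrict (Ioo a b)), ∫⁻ x in (Ω : Set (EuclideanSpace ℝ (Fin 3))), ‖u t x‖ₑ ^ 2 ≤ C) ∧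
      Tendsto (fun i => ∫⁻ z in Ioo a b ×ˢ (Ω : Set (EuclideanSpace ℝ (Fin 3))), ‖v (σ i) z.1 z.2 - u z.1 z.2‖ₑ ^ 2)
        atTop (𝓝 0) ∧
      ∀ φ : (EuclideanSpace ℝ (Fin 3)) → ℝ, FunctionSpaces.IsTestFunctionOn Ω φ →
        ∀ᵐ t ∂(volume.restrict (Ioo a b)),
          Tendsto (fun i => ∫ x in (Ω : Set (EuclideanSpace ℝ (Fin 3))), φ x • v (σ i) t x) atTop
            (𝓝 (∫ x in (Ω : Set (EuclideanSpace ℝ (Fin 3))), φ x • u t x)) := by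
  haveI : IsFiniteMeasure ((volume : Measure (EuclideanSpace ℝ (Fin 3))).restrict (Ω : Set (EuclideanSpace ℝ (Fin 3)))) := ⟨by
    rw [Measure.restrict_apply_univ]
    exact (measure_mono subset_closure).trans_lt hbΩ.isCompact_closure.measure_lt_top⟩
  -- measurability and the gradient hypotheses
  have hvm : ∀ k, AEStronglyMeasurable (uncurry (v k)) (volume.restrict (Ioo a b ×ˢ (Ω : Set (EuclideanSpace ℝ (Fin 3))))) :=
    fun k => (hsol k).1.aestronglyMeasurable
  choose G hGw hGb using hG
  have hGm : ∀ k, AEStronglyMeasurable (uncurry (G k)) (volume.restrict (Ioo a b ×ˢ (Ω : Set (EuclideanSpace ℝ (Fin 3))))) :=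
    fun k => (hGw k).locallyIntegrableOn_grad.aestronglyMeasurable
  have hGs : ∀ k, ∀ᵐ t ∂(volume.restrict (Ioo a b)),
      FunctionSpaces.HasWeakFDerivOn Ω volume (v k t) (G k t) :=
    fun k => (hGw k).ae_hasWeakFDerivOn_slice
  have hGb' : ∀ k, ∫⁻ z in Ioo a b ×ˢ (Ω : Set (EuclideanSpace ℝ (Fin 3))), ‖G k z.1 z.2‖ₑ ^ 2 ≤ Cg := fun k =>
    NSCylinder.lintegral_enorm_sq_le_of_frobenius (hGb k)
  -- equicontinuity of the pairings
  have hEC : ∀ φ : (EuclideanSpace ℝ (Fin 3)) → ℝ, FunctionSpaces.IsTestFunctionOn Ω φ →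
      ∃ ω : ℝ → ℝ, Tendsto ω (𝓝 0) (𝓝 0) ∧
        ∀ k, ∃ S : Set ℝ, (∀ᵐ t ∂(volume.restrict (Ioo a b)), t ∈ S) ∧
          ∀ t ∈ S, ∀ s ∈ S, ‖(∫ x in (Ω : Set (EuclideanSpace ℝ (Fin 3))), φ x • v k t x) -
            ∫ x in (Ω : Set (EuclideanSpace ℝ (Fin 3))), φ x • v k s x‖ ≤ ω (t - s) := by
    intro φ hφ
    have hη : ∀ i, FunctionSpaces.IsTestFunctionOn Ω
        (fun x => φ x • EuclideanSpace.basisFun (Fin 3) ℝ i) := fun i =>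
      NSCylinder.isTestFunctionOn_smul_const hφ _
    choose K₀ K₁ K₂ hK₀ hK₁ hK₂ using fun i => exists_bounds_of_isTestFunctionOn (hη i)
    -- the modulus
    obtain ⟨A, hA⟩ : ∃ A : Fin 3 → ℝ, A = fun i =>
        K₁ i * C.toReal + K₂ i * ((volume (Ω : Set (EuclideanSpace ℝ (Fin 3)))).toReal + C.toReal) := ⟨_, rfl⟩
    obtain ⟨B, hB⟩ : ∃ B : Fin 3 → ℝ, B = fun i => 3 * K₁ i *
        (((volume (Ω : Set (EuclideanSpace ℝ (Fin 3)))) ^ (1 / 2 : ℝ) * Cp) ^ (2 / 3 : ℝ)).toReal := ⟨_, rfl⟩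
    refine ⟨fun δ => ∑ i, (A i * |δ| + B i * |δ| ^ (1 / 3 : ℝ)), ?_, fun k => ?_⟩
    · have hc : Continuous fun δ : ℝ => ∑ i, (A i * |δ| + B i * |δ| ^ (1 / 3 : ℝ)) :=
        continuous_finsetSum _ fun i _ => (continuous_const.mul continuous_abs).add
          (continuous_const.mul (continuous_abs.rpow_const fun _ => Or.inr (by norm_num)))
      have h0 := hc.tendsto 0
      simpa [Real.zero_rpow (by norm_num : (1 / 3 : ℝ) ≠ 0)] using h0
    -- the good set for the `k`-th solution
    choose S hSae hS using fun i => NSCylinder.exists_fullMeasure_pairing_modulus (hsol k) hbΩ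
      hC hCp (hE k) (hP k) (hη i) (hK₁ i) (hK₂ i)
    have hslice := FunctionSpaces.AubinLions.ae_aestronglyMeasurable_slice (hvm k)
    refine ⟨{t | (∀ i, t ∈ S i) ∧
        AEStronglyMeasurable (v k t) (volume.restrict (Ω : Set (EuclideanSpace ℝ (Fin 3)))) ∧
        ∫⁻ x in (Ω : Set (EuclideanSpace ℝ (Fin 3))), ‖v k t x‖ₑ ^ 2 ≤ C}, ?_, ?_⟩
    · have hall : ∀ᵐ t ∂(volume.restrict (Ioo a b)), ∀ i, t ∈ S i := ae_all_iff.2 hSae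
      filter_upwards [hall, hslice, hE k] with t h1 h2 h3
      exact ⟨h1, h2, h3⟩
    rintro t ⟨htS, htm, htE⟩ s ⟨hsS, hsm, hsE⟩
    have hit : Integrable (fun x => φ x • v k t x) (volume.restrict (Ω : Set (EuclideanSpace ℝ (Fin 3)))) :=
      FunctionSpaces.Ehrling.integrable_smul_of_memLp_two hφ (NSCylinder.memLp_two_slice hC htm htE)
    have his : Integrable (fun x => φ x • v k s x) (volume.restrict (Ω : Set (EuclideanSpace ℝ (Fin 3)))) :=
      FunctionSpaces.Ehrling.integrable_smul_of_memLp_two hφ (NSCylinder.memLp_two_slice hC hsm hsE)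
    calc ‖(∫ x in (Ω : Set (EuclideanSpace ℝ (Fin 3))), φ x • v k t x) - ∫ x in (Ω : Set (EuclideanSpace ℝ (Fin 3))), φ x • v k s x‖
        ≤ ∑ i, |⟪(∫ x in (Ω : Set (EuclideanSpace ℝ (Fin 3))), φ x • v k t x) - ∫ x in (Ω : Set (EuclideanSpace ℝ (Fin 3))), φ x • v k s x,
            EuclideanSpace.basisFun (Fin 3) ℝ i⟫| := norm_le_sum_abs_inner_basisFun _
      _ = ∑ i, |(∫ x in (Ω : Set (EuclideanSpace ℝ (Fin 3))), ⟪v k t x, φ x • EuclideanSpace.basisFun (Fin 3) ℝ i⟫) -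
            ∫ x in (Ω : Set (EuclideanSpace ℝ (Fin 3))), ⟪v k s x, φ x • EuclideanSpace.basisFun (Fin 3) ℝ i⟫| := by
          refine Finset.sum_congr rfl fun i _ => ?_
          rw [inner_sub_left, NSCylinder.inner_integral_smul_eq hit,
            NSCylinder.inner_integral_smul_eq his]
      _ ≤ ∑ i, (A i * |t - s| + B i * |t - s| ^ (1 / 3 : ℝ)) := by
          refine Finset.sum_le_sum fun i _ => ?_
          have h := hS i t (htS i) s (hsS i)
          rw [hA, hB]
          linarith [h]
  -- the abstract compactness theorem
  obtain ⟨σ, u, hσ, hum, huE, hus, huP⟩ :=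
    FunctionSpaces.AubinLions.exists_subseq_strong_limit_of_equicontinuous (F := (EuclideanSpace ℝ (Fin 3)))
      hΩ hbΩ hC hCg hvm hE hGm hGs hGb' hEC
  exact ⟨σ, u, hσ, hum, huE, hus, huP⟩

/-- **Strong `L²` compactness of the velocities on `(a, b) × B(x₀, R)`**: the case of a ball
(balls are bounded Lipschitz domains, `isLipschitzDomain_ball`) of
`NSCylinder.exists_subseq_strong_limit_velocity`, the setting of Bradshaw–Tsai 2019, §4.3
(`W = (0, T) × B₁`) and Lin 1998, Thm. 2.2. [cite: BradshawTsai2019, §4.3 (proof of Thm 1.2)] [cite: Lemarierieusset2016, Thm. 12.1 (Rellich–Lions)] -/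
theorem NSCylinder.exists_subseq_strong_limit_velocity_ball (x₀ : (EuclideanSpace ℝ (Fin 3))) (R : ℝ) {a b : ℝ}
    {v : ℕ → ℝ → (EuclideanSpace ℝ (Fin 3)) → (EuclideanSpace ℝ (Fin 3))} {π : ℕ → ℝ → (EuclideanSpace ℝ (Fin 3)) → ℝ} {C Cg Cp : ℝ≥0∞}
    (hC : C ≠ ⊤) (hCg : Cg ≠ ⊤) (hCp : Cp ≠ ⊤)
    (hsol : ∀ k, IsDistributionalNSSolutionOn
      (timeCylinder (⟨ball x₀ R, isOpen_ball⟩ : Opens (EuclideanSpace ℝ (Fin 3))) a b) 1 0 (v k) (π k))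
    (hE : ∀ k, ∀ᵐ t ∂(volume.restrict (Ioo a b)), ∫⁻ x in ball x₀ R, ‖v k t x‖ₑ ^ 2 ≤ C)
    (hG : ∀ k, ∃ G : ℝ → (EuclideanSpace ℝ (Fin 3)) → (EuclideanSpace ℝ (Fin 3)) →L[ℝ] (EuclideanSpace ℝ (Fin 3)),
      HasWeakSpatialGradientOn (timeCylinder (⟨ball x₀ R, isOpen_ball⟩ : Opens (EuclideanSpace ℝ (Fin 3))) a b) (v k) G ∧
      ∫⁻ z in Ioo a b ×ˢ ball x₀ R, ENNReal.ofReal (frobeniusNormSq (G z.1 z.2)) ≤ Cg)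
    (hP : ∀ k, ∫⁻ z in Ioo a b ×ˢ ball x₀ R, ‖π k z.1 z.2‖ₑ ^ (3 / 2 : ℝ) ≤ Cp) :
    ∃ (σ : ℕ → ℕ) (u : ℝ → (EuclideanSpace ℝ (Fin 3)) → (EuclideanSpace ℝ (Fin 3))), StrictMono σ ∧
      AEStronglyMeasurable (uncurry u) (volume.restrict (Ioo a b ×ˢ ball x₀ R)) ∧
      (∀ᵐ t ∂(volume.restrict (Ioo a b)), ∫⁻ x in ball x₀ R, ‖u t x‖ₑ ^ 2 ≤ C) ∧
      Tendsto (fun i => ∫⁻ z in Ioo a b ×ˢ ball x₀ R, ‖v (σ i) z.1 z.2 - u z.1 z.2‖ₑ ^ 2)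
        atTop (𝓝 0) ∧
      ∀ φ : (EuclideanSpace ℝ (Fin 3)) → ℝ, FunctionSpaces.IsTestFunctionOn (⟨ball x₀ R, isOpen_ball⟩ : Opens (EuclideanSpace ℝ (Fin 3))) φ →
        ∀ᵐ t ∂(volume.restrict (Ioo a b)),
          Tendsto (fun i => ∫ x in ball x₀ R, φ x • v (σ i) t x) atTop
            (𝓝 (∫ x in ball x₀ R, φ x • u t x)) :=
  NSCylinder.exists_subseq_strong_limit_velocity (Ω := (⟨ball x₀ R, isOpen_ball⟩ : Opens (EuclideanSpace ℝ (Fin 3))))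
    (FunctionSpaces.isLipschitzDomain_ball x₀ R) isBounded_ball hC hCg hCp hsol hE hG hP

end Package

end Literature.Analysis.FluidPDE
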